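import Literature.Analysis.ValidatedNumerics.MultiPrecisionInterval
import Literature.Analysis.ValidatedNumerics.KernelData
import Mathlib.Analysis.SpecialFunctions.Pow.Real

/-!
# Kernel arithmetic for point-functional certificates (pub-ising3d, architecture B″): real powers

The interval half of the kernel evaluator for the tables of `boxExcluded_of_pointTable_twist`:
enclosures, at a binary scale `S` (`Literature.Analysis.ValidatedNumerics.NumericsMP.MI`, `MI.mem S`),
of real powers `b^e` of a rational base `b = p/q > 0` with rational exponent `e`, WITHOUT
transcendental functions in the kernel. The certificate supplies, per base, interval "atoms"
`A_t ∋ b^{ρ_t}` for a short list of rational exponents `ρ_t = a_t/d_t ∈ ℚ_{>0}` (a dyadic step, the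
external-dimension end points `s_lo`, `s_hi`, …); the kernel CHECKS each atom by one exact integer
comparison (`checkRoot`: `lo^d q^a ≤ p^a S^d ≤ hi^d q^a`, `mem_of_checkRoot`) and assembles every power
it needs as `b^{m₊-m₋} · A_{t₁}^{n₁} · A_{t₂}^{n₂}` (`PowReq`, `evalPow`, binary powering `powBin`),
the exponent bookkeeping `e = m₊ - m₋ + n₁ ρ_{t₁} + n₂ ρ_{t₂}` being a decidable identity in `ℚ`
(`PowReq.expo`). Main result: `mem_evalPow`. [folklore]
-/

namespace Literature.MathematicalPhysics.QuantumFieldTheory.ConformalBootstrap3D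

namespace PointKernel

open Literature.Analysis.ValidatedNumerics (vget vget_of_length_le)
open Literature.Analysis.ValidatedNumerics.NumericsMP

/-! ### Binary powering of an interval -/

/-- `I^n` by binary powering, structural on a fuel argument (`n < 2^fuel` needed). [folklore] -/
def powBin (S : ℕ) (I : MI) : ℕ → ℕ → MI
  | 0, _ => MI.ofInt S 1
  | fuel + 1, n =>
    if n = 0 then MI.ofInt S 1
    else
      let H := powBin S I fuel (n / 2)
      if n % 2 = 0 then MI.sqr S H else MI.mul S (MI.sqr S H) I

/-- [folklore] -/
theorem mem_powBin {S : ℕ} (hS : 0 < S) {x : ℝ} {I : MI} (hx : MI.mem S x I) :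
    ∀ fuel n : ℕ, n < 2 ^ fuel → MI.mem S (x ^ n) (powBin S I fuel n)
  | 0, n, h => by
    have hn : n = 0 := by simpa using h
    subst hn
    simp only [powBin]
    simpa using MI.mem_ofInt S 1
  | fuel + 1, n, h => by
    simp only [powBin]
    split_ifs with h0 h2
    · subst h0; simpa using MI.mem_ofInt S 1
    · have hlt : n / 2 < 2 ^ fuel := by
        rw [Nat.div_lt_iff_lt_mul (by norm_num)]; rw [pow_succ] at h; omega
      have ih := mem_powBin hS hx fuel (n / 2) hlt
      have hn : x ^ n = (x ^ (n / 2)) ^ 2 := by rw [← pow_mul]; congr 1; omega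
      rw [hn]; exact MI.mem_sqr hS ih
    · have hlt : n / 2 < 2 ^ fuel := by
        rw [Nat.div_lt_iff_lt_mul (by norm_num)]; rw [pow_succ] at h; omega
      have ih := mem_powBin hS hx fuel (n / 2) hlt
      have hn : x ^ n = (x ^ (n / 2)) ^ 2 * x := by rw [← pow_mul, ← pow_succ]; congr 1; omega
      rw [hn]; exact MI.mem_mul hS (MI.mem_sqr hS ih) hx

/-! ### Root atoms -/

/-- Kernel check that `R` encloses `(p/q)^{a/d}` at scale `S`:
`0 ≤ R.lo`, `0 ≤ R.hi`, `R.lo^d q^a ≤ p^a S^d` and `p^a S^d ≤ R.hi^d q^a` (exact integers). [folklore] -/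
def checkRoot (S p q a d : ℕ) (R : MI) : Bool :=
  decide (0 ≤ R.lo) && decide (0 ≤ R.hi) &&
    decide (R.lo ^ d * (q : ℤ) ^ a ≤ (p : ℤ) ^ a * (S : ℤ) ^ d) &&
    decide ((p : ℤ) ^ a * (S : ℤ) ^ d ≤ R.hi ^ d * (q : ℤ) ^ a)

/-- **Soundness of the root check.** [folklore] -/
theorem mem_of_checkRoot {S p q a d : ℕ} (hS : 0 < S) (hp : 0 < p) (hq : 0 < q) (hd : 0 < d) {R : MI}
    (h : checkRoot S p q a d R = true) : MI.mem S (((p : ℝ) / q) ^ ((a : ℝ) / d)) R := by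
  simp only [checkRoot, Bool.and_eq_true, decide_eq_true_eq] at h
  obtain ⟨⟨⟨hlo, hhi⟩, h1⟩, h2⟩ := h
  have hb : (0 : ℝ) < (p : ℝ) / q := by positivity
  set t : ℝ := ((p : ℝ) / q) ^ ((a : ℝ) / d) with ht
  have ht0 : 0 ≤ t := Real.rpow_nonneg hb.le _
  have htd : t ^ d = ((p : ℝ) / q) ^ a := by
    rw [ht, ← Real.rpow_natCast, ← Real.rpow_mul hb.le, div_mul_cancel₀ _ (by positivity),
      Real.rpow_natCast]
  have hSR : (0 : ℝ) < S := by exact_mod_cast hS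
  have hqR : (0 : ℝ) < q := by exact_mod_cast hq
  have hdn : d ≠ 0 := hd.ne'
  refine ⟨?_, ?_⟩
  · -- lower: (lo/S)^d ≤ (p/q)^a
    have hloR : (0 : ℝ) ≤ (R.lo : ℝ) := by exact_mod_cast hlo
    have h1R : ((R.lo : ℝ)) ^ d * (q : ℝ) ^ a ≤ (p : ℝ) ^ a * (S : ℝ) ^ d := by exact_mod_cast h1
    have key : ((R.lo : ℝ) / S) ^ d ≤ t ^ d := by
      rw [htd, div_pow, div_pow, div_le_div_iff₀ (by positivity) (by positivity)]
      linarith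
    have := le_of_pow_le_pow_left₀ hdn ht0 key
    rwa [div_le_iff₀ hSR] at this
  · -- upper: (p/q)^a ≤ (hi/S)^d
    have hhiR : (0 : ℝ) ≤ (R.hi : ℝ) / S := by positivity
    have h2R : (p : ℝ) ^ a * (S : ℝ) ^ d ≤ ((R.hi : ℝ)) ^ d * (q : ℝ) ^ a := by exact_mod_cast h2
    have key : t ^ d ≤ ((R.hi : ℝ) / S) ^ d := by
      rw [htd, div_pow, div_pow, div_le_div_iff₀ (by positivity) (by positivity)]
      linarith
    have := le_of_pow_le_pow_left₀ hdn hhiR key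
    rwa [le_div_iff₀ hSR] at this

/-- Check a list of atoms `A_t ∋ (p/q)^{ρ_t}`, `ρ_t = (num, den)` pairs. [folklore] -/
def checkAtoms (S p q : ℕ) : List (ℕ × ℕ) → List MI → Bool
  | [], [] => true
  | (a, d) :: ρ, R :: A => decide (0 < d) && checkRoot S p q a d R && checkAtoms S p q ρ A
  | _, _ => false

/-- The exponent `ρ_t` of atom `t` as a rational (`0` beyond the list). [folklore] -/
def atomExp (ρ : List (ℕ × ℕ)) (t : ℕ) : ℚ := ((ρ.getD t (0, 1)).1 : ℚ) / (ρ.getD t (0, 1)).2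

/-- The interval of atom `t` (`[1, 1]` beyond the list, matching `atomExp = 0`). [folklore] -/
def atomMI (S : ℕ) (A : List MI) (t : ℕ) : MI := A.getD t (MI.ofInt S 1)

/-- **Soundness of the atom table.** [folklore] -/
theorem mem_atomMI {S p q : ℕ} (hS : 0 < S) (hp : 0 < p) (hq : 0 < q) :
    ∀ (ρ : List (ℕ × ℕ)) (A : List MI), checkAtoms S p q ρ A = true →
      ∀ t, MI.mem S (((p : ℝ) / q) ^ ((atomExp ρ t : ℚ) : ℝ)) (atomMI S A t)
  | [], [], _, t => by
    simp only [atomExp, atomMI, List.getD_nil]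
    norm_num
    simpa using MI.mem_ofInt S 1
  | (a, d) :: ρ, R :: A, h, t => by
    simp only [checkAtoms, Bool.and_eq_true, decide_eq_true_eq] at h
    obtain ⟨⟨hd, hR⟩, hrest⟩ := h
    cases t with
    | zero =>
      simp only [atomExp, atomMI, List.getD_cons_zero]
      have := mem_of_checkRoot hS hp hq hd hR
      convert this using 2
      push_cast; ring
    | succ t =>
      simp only [atomExp, atomMI, List.getD_cons_succ]
      exact mem_atomMI hS hp hq ρ A hrest t
  | [], _ :: _, h, _ => by simp [checkAtoms] at h
  | _ :: _, [], h, _ => by simp [checkAtoms] at h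

/-! ### Power requests -/

/-- A power request: the exponent `e = m₊ - m₋ + n₁ ρ_{t₁} + n₂ ρ_{t₂}` is assembled from an
integer part and two atoms. [folklore] -/
structure PowReq where
  /-- positive integer part -/
  mpos : ℕ
  /-- negative integer part -/
  mneg : ℕ
  /-- first atom index and multiplicity -/
  t1 : ℕ
  n1 : ℕ
  /-- second atom index and multiplicity -/
  t2 : ℕ
  n2 : ℕ
deriving DecidableEq

/-- The exponent a request stands for. [folklore] -/
def PowReq.expo (ρ : List (ℕ × ℕ)) (r : PowReq) : ℚ :=
  (r.mpos : ℚ) - r.mneg + atomExp ρ r.t1 * r.n1 + atomExp ρ r.t2 * r.n2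

/-- Interval value of a request for the base `p/q` with atom table `A`:
`(p^{m₊} q^{m₋})/(q^{m₊} p^{m₋}) · A_{t₁}^{n₁} · A_{t₂}^{n₂}`. [folklore] -/
def evalPow (S p q : ℕ) (A : List MI) (r : PowReq) : MI :=
  MI.mul S
    (MI.mul S (MI.ofFrac S ((p : ℤ) ^ r.mpos * (q : ℤ) ^ r.mneg) (q ^ r.mpos * p ^ r.mneg))
      (powBin S (atomMI S A r.t1) 64 r.n1))
    (powBin S (atomMI S A r.t2) 64 r.n2)

/-- Multiplicities within the fuel of `powBin`. [folklore] -/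
def PowReq.ok (r : PowReq) : Bool := decide (r.n1 < 2 ^ 64) && decide (r.n2 < 2 ^ 64)

/-- **Soundness of power requests.** [folklore] -/
theorem mem_evalPow {S p q : ℕ} (hS : 0 < S) (hp : 0 < p) (hq : 0 < q) {ρ : List (ℕ × ℕ)}
    {A : List MI} (hA : checkAtoms S p q ρ A = true) (r : PowReq) (hr : r.ok = true) :
    MI.mem S (((p : ℝ) / q) ^ ((r.expo ρ : ℚ) : ℝ)) (evalPow S p q A r) := by
  simp only [PowReq.ok, Bool.and_eq_true, decide_eq_true_eq] at hr
  have hb : (0 : ℝ) < (p : ℝ) / q := by positivity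
  have hpR : (p : ℝ) ≠ 0 := by positivity
  have hqR : (q : ℝ) ≠ 0 := by positivity
  have e1 := mem_powBin hS (mem_atomMI hS hp hq ρ A hA r.t1) 64 r.n1 hr.1
  have e2 := mem_powBin hS (mem_atomMI hS hp hq ρ A hA r.t2) 64 r.n2 hr.2
  have e0 : MI.mem S ((((p : ℤ) ^ r.mpos * (q : ℤ) ^ r.mneg : ℤ) : ℝ) / ((q ^ r.mpos * p ^ r.mneg : ℕ) : ℝ))
      (MI.ofFrac S ((p : ℤ) ^ r.mpos * (q : ℤ) ^ r.mneg) (q ^ r.mpos * p ^ r.mneg)) :=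
    MI.mem_ofFrac S _ (by positivity)
  have := MI.mem_mul hS (MI.mem_mul hS e0 e1) e2
  unfold evalPow
  convert this using 2
  -- the exponent identity
  rw [← Real.rpow_natCast (((p : ℝ) / q) ^ (((atomExp ρ r.t1 : ℚ) : ℝ))) r.n1,
    ← Real.rpow_natCast (((p : ℝ) / q) ^ (((atomExp ρ r.t2 : ℚ) : ℝ))) r.n2,
    ← Real.rpow_mul hb.le, ← Real.rpow_mul hb.le]
  have hint : ((((p : ℤ) ^ r.mpos * (q : ℤ) ^ r.mneg : ℤ) : ℝ) / ((q ^ r.mpos * p ^ r.mneg : ℕ) : ℝ))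
      = ((p : ℝ) / q) ^ (((r.mpos : ℚ) - r.mneg : ℚ) : ℝ) := by
    push_cast
    rw [Real.rpow_sub hb, Real.rpow_natCast, Real.rpow_natCast, div_pow, div_pow]
    field_simp
  rw [hint, ← Real.rpow_add hb, ← Real.rpow_add hb]
  congr 1
  simp only [PowReq.expo]
  push_cast
  ring

end PointKernel

end Literature.MathematicalPhysics.QuantumFieldTheory.ConformalBootstrap3D
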